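import Literature.NumberTheory.GelbartRogawski1991.OscillatorTripleDictionary
import HarnessLib

/-!
# [Liu 2021] proof of Prop. 4.13: occurrence in `H¹_{B,τ'}(A_∞, ℂ)` is transported along equivariant isomorphisms;
# the junction «Matsushima-contributes ∧ theta-realises ⟹ every admissible `ω(μ,ε,χ)` occurs» (cell node B3-13) in binder form

Topic `NumberTheory/Automorphic/Liu2021`.  KERNEL ONLY: theorems, no definition, no named fact, no `sorry`; companion of
`Prop413ConstituentsOfReference` / `Prop413ConstituentsOfDictionary` (same datum `P : Prop413Data F E`, same currencies `OccursInH1` /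
`IsIsoToOmega` of `GelbartRogawski1991.OscillatorTripleDictionary`).

* `occursInH1_of_equiv` — if `σ ≅ σ'` `𝔾(𝔸_F^∞)`-equivariantly and `σ` admits a non-zero intertwiner into `H¹_{B,τ'}(A_∞, ℂ)`, so does
  `σ'` ([Liu2021, proof of Prop. 4.13, l. 2131]: «contributes to the Albanese» depends only on the isomorphism class of `π^∞`);
* `occursInH1_rhoAt_of_isIsoToOmega` — `σ ≅ ω_t` and `σ` occurs ⟹ `ω_t` occurs;
* `occursInH1_rhoAt_of_realisation` — Liu's argument at l. 2145 in BINDER form over ANY carrier `Aut` of (discrete automorphic)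
  representations `π` with finite parts `fin π` and a flag `H1ne τ' π` («`H¹(𝔤,K_G;π_∞)_{τ'} ≠ 0`»): IF (M) every `π` with `H1ne τ' π`
  contributes (Matsushima's formula read at the datum) and (Θ) every admissible weight-one `t` is realised by some `π` with `H1ne τ' π`
  and `fin π ≅ ω_t` (global theta lift + Rallis non-vanishing + Howe duality + archimedean correspondence), THEN every admissible `ω_t`
  occurs — the «`≥ 1`» half (J3b) of the printed multiplicity one `MultOneAsPrinted`.  No carrier is fixed; nothing is asserted.

(These three theorems were first proposed as an append to `Prop413ConstituentsOfReference.lean` — proposals p596354 / p598520,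
stalled in the gate queue — and are landed here as their own module instead.)

## References
* [Liu2021] Y. Liu, *Fourier–Jacobi cycles and arithmetic relative trace formula*, Camb. J. Math. **9** (2021) = arXiv:2102.11518 —
  proof of Prop. 4.13, l. 2131 («contributes»), l. 2145 («Conversely … by the Rallis inner product formula …»).
* Tree: `GelbartRogawski1991/OscillatorTripleDictionary.lean` (`OccursInH1`, `IsIsoToOmega`, `rhoTriple`).
-/

noncomputable section

open NumberField

namespace Literature.NumberTheory.Automorphic.Liu2021

namespace Prop413Data

open Literature.NumberTheory.GelbartRogawski1991 Literature.NumberTheory.GelbartRogawski1991.OscillatorTripleDictionary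

variable {F E : Type} [Field F] [NumberField F] [IsTotallyReal F] [Field E] [NumberField E] [Algebra F E]
  [IsTotallyComplex E] [Algebra.IsQuadraticExtension F E] {P : Prop413Data F E}

/-! ## Occurrence is transported along equivariant isomorphisms; the junction «realisation ⟹ occurrence» in binder form -/

/-- **Occurrence in `H¹_{B,τ'}(A_∞, ℂ)` is invariant under `𝔾(𝔸_F^∞)`-equivariant isomorphism**: if `σ ≅ σ'` equivariantly and `σ`
admits a non-zero intertwiner into `H¹_{B,τ'}`, so does `σ'` (compose with the inverse isomorphism). Bookkeeping on [Liu2021, proof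
of Prop. 4.13, l. 2131] («contributes to the Albanese» depends only on the isomorphism class of `π^∞`).
[cite: Liu2021, proof of Prop. 4.13, l. 2131] -/
theorem occursInH1_of_equiv {τ' : E →+* ℂ} {V V' : Type} [AddCommGroup V] [Module ℂ V] [AddCommGroup V'] [Module ℂ V']
    {σ : Representation ℂ P.G V} {σ' : Representation ℂ P.G V'} (f : V ≃ₗ[ℂ] V')
    (hf : ∀ (g : P.G) (v : V), f (σ g v) = σ' g (f v)) (h : OccursInH1 P τ' σ) : OccursInH1 P τ' σ' := by
  obtain ⟨j, hj⟩ := h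
  have hf' : ∀ (g : P.G) (v' : V'), f.symm (σ' g v') = σ g (f.symm v') := fun g v' => by
    rw [LinearEquiv.symm_apply_eq, hf, LinearEquiv.apply_symm_apply]
  refine ⟨LinearMap.intertwiningMap_of_isIntertwiningMap σ' (P.rhoB τ') (j.toLinearMap ∘ₗ f.symm.toLinearMap)
    (fun g v' => ?_), fun h0 => hj ?_⟩
  · simp only [LinearMap.coe_comp, LinearEquiv.coe_coe, Function.comp_apply, hf',
      Representation.IntertwiningMap.coe_toLinearMap]
    exact Representation.IntertwiningMap.isIntertwining σ (P.rhoB τ') j g (f.symm v')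
  · apply Representation.IntertwiningMap.ext
    apply LinearMap.ext
    intro v
    have h1 := congrArg (fun k : Representation.IntertwiningMap σ' (P.rhoB τ') => k (f v)) h0
    simpa using h1

/-- **`σ ≅ ω_t` and `σ` occurs ⟹ `ω_t` occurs** (`IsIsoToOmega` currency; for an admissible weight-one `t`).
[cite: Liu2021, proof of Prop. 4.13, l. 2131 and l. 2145] -/
theorem occursInH1_rhoAt_of_isIsoToOmega {τ' : E →+* ℂ} {V : Type} [AddCommGroup V] [Module ℂ V]
    {σ : Representation ℂ P.G V} (t : P.AdmTriple) (hiso : IsIsoToOmega P σ t.1) (h : OccursInH1 P τ' σ) :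
    OccursInH1 P τ' (P.rhoAt t) := by
  obtain ⟨f, hf⟩ := hiso
  exact occursInH1_of_equiv f hf h

/-- **The junction «realisation ⟹ occurrence» (cell hodgecm-mathlib node B3-13), in BINDER form** — the shape of Liu's argument
at l. 2145: «for every such adèlic oscillator triple `(μ,ε,χ)`, there exists a pair `(W, π_W)` … if we denote by `π` an irreducible
subrepresentation of `Θ^V_{(μ,ν),W}(π_W)`, then `ω(μ,ε,χ)` is isomorphic to `π^∞` and `H¹(𝔤, K_G; π_∞) ≠ {0}`. Moreover, by the
Rallis inner product formula, `Θ^V_{(μ,ν),W}(π_W)` is contained in `L²_disc(G)`. Thus, we may apply the above discussions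
[Matsushima, l. 2131] to the representation `π`».  Over ANY carrier `Aut` of (discrete automorphic) representations `π` with finite
parts `fin π : 𝔾(𝔸_F^∞) → GL(finV π)` and a flag `H1ne τ' π` («`H¹(𝔤,K_G;π_∞)_{τ'} ≠ 0`»): IF (M) every `π` with `H1ne τ' π`
contributes (`fin π` occurs in `H¹_{B,τ'}(A_∞, ℂ)` — Matsushima's formula read at the datum) and (Θ) every admissible weight-one `t` is
realised (`∃ π, H1ne τ' π ∧ fin π ≅ ω_t` — theta lift + Rallis non-vanishing + Howe duality + archimedean correspondence), THEN every
admissible `ω_t` occurs.  No carrier is fixed here (binders only); nothing of the sources is asserted.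
[cite: Liu2021, proof of Prop. 4.13, l. 2131 and l. 2145] -/
theorem occursInH1_rhoAt_of_realisation {Aut : Type} {finV : Aut → Type} [∀ π, AddCommGroup (finV π)]
    [∀ π, Module ℂ (finV π)] (fin : ∀ π, Representation ℂ P.G (finV π)) (H1ne : (E →+* ℂ) → Aut → Prop)
    (hM : ∀ (τ' : E →+* ℂ) (π : Aut), H1ne τ' π → OccursInH1 P τ' (fin π))
    (hΘ : ∀ (τ' : E →+* ℂ) (t : P.AdmTriple), ∃ π : Aut, H1ne τ' π ∧ IsIsoToOmega P (fin π) t.1)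
    (τ' : E →+* ℂ) (t : P.AdmTriple) : OccursInH1 P τ' (P.rhoAt t) := by
  obtain ⟨π, hπ, hiso⟩ := hΘ τ' t
  exact occursInH1_rhoAt_of_isIsoToOmega t hiso (hM τ' π hπ)

end Prop413Data

end Literature.NumberTheory.Automorphic.Liu2021

end
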